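import Literature.NumberTheory.GaloisCohomology.Howard2004.DVRKolyvaginBound
import Literature.NumberTheory.GaloisCohomology.Howard2004.DVRLevelRaisingInjectiveProofs
import Mathlib.LinearAlgebra.Dual.Basis
import HarnessLib

/-!
# Howard 2004, H.4/H.5(c): the residual pairing `T̄ × T̄ → (R/𝔪)(1)` as a duality datum on `T̄`
# (existence theorem; theorems only)

Topic `NumberTheory/GaloisCohomology/Howard2004`. THEOREMS ONLY: no definition, no named fact, no
instance, no notation, no `sorry`. Cell `pub/bsd-print-x9`, print leaf G87
`Literature.NumberTheory.GaloisCohomology.Howard2004.thm161_dvrKolyvaginBound` (Howard Thm. 1.6.1);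
seat `bsd-line-x10b-p1-w5` g7. Every duality statement of §1.5 at the RESIDUAL level (Lemma 1.5.3's
isotropy «`⟨c_ℓ, c_ℓ⟩_ℓ = 0`», the eigenline form of global duality, the self-orthogonality of
`𝓕̄`) needs Howard's H.4 data ON `T̄`; the tree carries a `DualityDatum` on every level `T^{(k)}`
(`DVRSetting.D k`) but none on `T̄`. This file produces one, as an EXISTENCE theorem (so that
`RelaxedSelmerIsotropyProofs`, `DualityDatum.IsSelfOrthogonalAt`, … apply to `ρbar` verbatim).

SOURCE. B. Howard, Compositio Math. **140** (2004) = arXiv:1202.6340, §1.3: H.4 «a perfect, symmetric,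
`R`-bilinear pairing `( , ) : T × T → R(1)` satisfying `(s^σ, t^{τστ⁻¹}) = (s, t)^σ`» (p. 7 L69–80) and
H.5(c) «if H.4 is assumed to hold then the residual pairing `T̄ × T̄ → (R/𝔪)(1)` satisfies
`(s^τ, t^τ) = (s, t)^τ`» (p. 7 L98 – p. 8 L1); §1.5 works with `R` principal Artinian of length `k`
(p. 9 L103–104) and `T̄ = T/𝔪T`.

THE CONSTRUCTION. For a level ring `A` (local, with `ϖ ∈ A` and `e ≥ 1` such that `𝔪_A ⊆ ϖA`,
`ϖ^e = 0`, `ϖ·a = 0 ⇒ a ∈ ϖ^{e−1}A`, `ϖ^{e−1}·a = 0 ⇒ a ∈ 𝔪_A` — i.e. `A = R/𝔪^e` for a DVR `R`,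
§3), the residue field `A/𝔪` is identified with the SOCLE `ϖ^{e−1}A = A[𝔪]` by `x ↦ ϖ^{e−1} x`, and
Howard's residual pairing becomes the `A`-bilinear, `A`-VALUED pairing
`ē(s̄, t̄) := ϖ^{e−1} · e(s, t)` on `T̄ = T/𝔪T` (well defined: `e(𝔪T, T) ⊆ 𝔪` and `ϖ^{e−1}𝔪 = 0`).
It is symmetric, `Γ_K`-equivariant with the same twist `R(1)`, and PERFECT in the sense of
`DualityDatum` (`T̄ → Hom_A(T̄, A)` bijective): injective because `ē(s̄, ·) = 0` forces
`e(s, ·) ∈ 𝔪·Hom(T, A)`, i.e. `s ∈ 𝔪T` (dual basis + perfectness of `e`); surjective because every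
`A`-linear `T̄ → A` takes values in the socle and lifts through `e♭⁻¹` (basis again).

WHAT IS PROVED.
* §1 `DualityDatum.e_mem_maximalIdeal_of_mem` (`e(𝔪T, T) ⊆ 𝔪`), **`DualityDatum.exists_residual`**
  (generic level ring `A`, `T` finite free): `∃ D̄ : DualityDatum p cd ρbar A` with
  `D̄.e (π̄ s) (π̄ t) = ϖ^{e−1} · D.e s t` and `D̄.twistOne = D.twistOne`.
* §2 `DualityDatum.residual_e_theta_theta`: under H.5(c) any such `D̄` satisfies
  `D̄.e (θ x) (θ y) = −D̄.e x y` (`(s^τ, t^τ) = (s, t)^τ`, `τ` acting by `−1` on `(R/𝔪)(1)`).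
* §3 **`DVRSetting.exists_residualDualityDatum`**: on a `DVRSetting` with H.0–H.5, at every level `k`,
  `∃ D̄ : DualityDatum p S.cd S.ρbar (Rk k)` with `D̄.e (π̄_k s) (π̄_k t) = π^{e_k−1} · (S.D k).e s t`,
  `D̄.twistOne = (S.D k).twistOne` and `D̄.e (θ x) (θ y) = −D̄.e x y` (the four ring facts for
  `R_k = R/𝔪^{e_k}` from `unif`, `ker_algebraMap`, `algebraMap_surjective`, `e_zero`; freeness from H.0).

NOT HERE: self-orthogonality of the propagated structure `𝓕̄` for `D̄` (H.4 for `T̄`), eigenlines,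
`thm161_dvrKolyvaginBound` — NOT proved; no summit statement is proved; the Birch–Swinnerton-Dyer
conjecture is not proved by any of this.
References: [Howard2004HeegnerKolyvagin] §1.3 H.4, H.5(c), §1.5 (arXiv p. 7, p. 9);
[MazurRubinMemoirs2004] §2.1 (self-dual `T/𝔪T`).
-/

set_option autoImplicit false

noncomputable section

open Function NumberField IsDedekindDomain Field
open scoped NumberField

namespace Literature.NumberTheory.GaloisCohomology.Howard2004

open Literature.NumberTheory.GaloisRepresentations
open Literature.NumberTheory.GaloisRepresentations.DiscreteGaloisModule

variable {K : Type} [Field K] [NumberField K] {M : Type} [AddCommGroup M] [TopologicalSpace M]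
  [DiscreteTopology M] {Nbar : Type} [AddCommGroup Nbar] [TopologicalSpace Nbar]
  [DiscreteTopology Nbar] {A : Type} [CommRing A] [TopologicalSpace A] [DiscreteTopology A]
  {p : ℕ} [Fact p.Prime] [Algebra ℤ_[p] A] [Module A M] [Module A Nbar]
  {cd : ConjugationDatum K} {ρ : DiscreteGaloisModule K M} {ρbar : DiscreteGaloisModule K Nbar}

namespace DualityDatum

/-! ## §1 The residual pairing `ē(s̄, t̄) = ϖ^{e−1} e(s, t)` -/

/-- `e(𝔪T, T) ⊆ 𝔪` (bilinearity). [cite: Howard2004HeegnerKolyvagin, §1.3 H.4/H.5(c) (arXiv p. 7 L69–80, L98: «the residual pairing `T̄ × T̄ → R/𝔪(1)`»)] -/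
theorem e_mem_maximalIdeal_of_mem [IsLocalRing A] (D : DualityDatum p cd ρ A) {s : M}
    (hs : s ∈ (IsLocalRing.maximalIdeal A) • (⊤ : Submodule A M)) (t : M) :
    D.e s t ∈ IsLocalRing.maximalIdeal A := by
  refine Submodule.smul_induction_on hs (fun a ha m _ => ?_) (fun x y hx hy => ?_)
  · rw [map_smul, LinearMap.smul_apply, smul_eq_mul]
    exact Ideal.mul_mem_right _ _ ha
  · rw [map_add, LinearMap.add_apply]
    exact Ideal.add_mem _ hx hy

/-- **The residual duality datum exists** (generic level ring). Let `A` be local with `ϖ ∈ A`, `e ≥ 1`,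
`𝔪_A ⊆ ϖA`, `ϖ^e = 0`, socle `A[ϖ] ⊆ ϖ^{e−1}A`, and `ann(ϖ^{e−1}) ⊆ 𝔪_A`; `T` finite free over `A`
with H.4 datum `D`; `π̄ : T ↠ T̄` a residual presentation (kernel `𝔪T`). Then there is a duality datum
`D̄` on `T̄` over `A` with `D̄.e (π̄ s) (π̄ t) = ϖ^{e−1} · D.e s t` (Howard's residual pairing
`T̄ × T̄ → (R/𝔪)(1)`, the residue field sitting in `A(1)` as the socle `ϖ^{e−1}A`) and the same twist
`R(1)`: symmetric, perfect, `Γ_K`-equivariant.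
[cite: Howard2004HeegnerKolyvagin, §1.3 H.4 and H.5(c) (arXiv p. 7 L69–80; p. 7 L98 – p. 8 L1)] [cite: MazurRubinMemoirs2004, §2.1] -/
theorem exists_residual [IsLocalRing A] [Module.Free A M] [Module.Finite A M]
    (D : DualityDatum p cd ρ A) {πbar : M →ₗ[A] Nbar}
    (hq : IsQuotientBy ρ (IsLocalRing.maximalIdeal A) ρbar πbar) (ϖ : A) (e : ℕ) (he : 1 ≤ e)
    (hmax : ∀ a ∈ IsLocalRing.maximalIdeal A, ∃ a', a = ϖ * a') (hnil : ϖ ^ e = 0)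
    (hsoc : ∀ a : A, ϖ * a = 0 → ∃ a', a = ϖ ^ (e - 1) * a')
    (hann : ∀ a : A, ϖ ^ (e - 1) * a = 0 → a ∈ IsLocalRing.maximalIdeal A) :
    ∃ Dbar : DualityDatum p cd ρbar A,
      (∀ s t : M, Dbar.e (πbar s) (πbar t) = ϖ ^ (e - 1) * D.e s t) ∧ Dbar.twistOne = D.twistOne := by
  classical
  -- `ϖ^{e-1}` kills `𝔪`
  have hkill : ∀ a ∈ IsLocalRing.maximalIdeal A, ϖ ^ (e - 1) * a = 0 := by
    intro a ha
    obtain ⟨a', rfl⟩ := hmax a ha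
    rw [← mul_assoc, ← pow_succ, Nat.sub_add_cancel he, hnil, zero_mul]
  -- the scaled pairing is constant on the fibres of `π̄`
  have hwd : ∀ s s' t : M, πbar s = πbar s' → ϖ ^ (e - 1) * D.e s t = ϖ ^ (e - 1) * D.e s' t := by
    intro s s' t h
    have hmem : s - s' ∈ (IsLocalRing.maximalIdeal A) • (⊤ : Submodule A M) := by
      rw [← hq.ker_eq, LinearMap.mem_ker, map_sub, h, sub_self]
    have h0 := hkill _ (D.e_mem_maximalIdeal_of_mem hmem t)
    rw [map_sub, LinearMap.sub_apply, mul_sub, sub_eq_zero] at h0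
    exact h0
  have hwd' : ∀ s t t' : M, πbar t = πbar t' → ϖ ^ (e - 1) * D.e s t = ϖ ^ (e - 1) * D.e s t' := by
    intro s t t' h
    rw [D.symm s t, D.symm s t', hwd t t' s h]
  -- a set-theoretic section of `π̄`
  let σ : Nbar → M := surjInv hq.surjective
  have hσ : ∀ x, πbar (σ x) = x := surjInv_eq hq.surjective
  let f : Nbar → Nbar → A := fun x y => ϖ ^ (e - 1) * D.e (σ x) (σ y)
  have hf : ∀ s t : M, f (πbar s) (πbar t) = ϖ ^ (e - 1) * D.e s t := by
    intro s t
    change ϖ ^ (e - 1) * D.e (σ (πbar s)) (σ (πbar t)) = _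
    rw [hwd (σ (πbar s)) s _ (hσ _), hwd' s (σ (πbar t)) t (hσ _)]
  -- the bilinear map
  let ebar : Nbar →ₗ[A] Nbar →ₗ[A] A := LinearMap.mk₂ A f
    (fun x x' y => by
      obtain ⟨s, rfl⟩ := hq.surjective x
      obtain ⟨s', rfl⟩ := hq.surjective x'
      obtain ⟨t, rfl⟩ := hq.surjective y
      rw [← map_add, hf, hf, hf, map_add, LinearMap.add_apply, mul_add])
    (fun a x y => by
      obtain ⟨s, rfl⟩ := hq.surjective x
      obtain ⟨t, rfl⟩ := hq.surjective y
      rw [← map_smul, hf, hf, map_smul, LinearMap.smul_apply, smul_eq_mul, smul_eq_mul,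
        mul_left_comm])
    (fun x y y' => by
      obtain ⟨s, rfl⟩ := hq.surjective x
      obtain ⟨t, rfl⟩ := hq.surjective y
      obtain ⟨t', rfl⟩ := hq.surjective y'
      rw [← map_add, hf, hf, hf, map_add, mul_add])
    (fun a x y => by
      obtain ⟨s, rfl⟩ := hq.surjective x
      obtain ⟨t, rfl⟩ := hq.surjective y
      rw [← map_smul, hf, hf, map_smul, smul_eq_mul, smul_eq_mul, mul_left_comm])
  have hebar : ∀ s t : M, ebar (πbar s) (πbar t) = ϖ ^ (e - 1) * D.e s t := fun s t => hf s t
  -- a basis of `T` and the adjoint isomorphism `e♭ : T ≃ Hom(T, A)`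
  let b := Module.Free.chooseBasis A M
  haveI : Fintype (Module.Free.ChooseBasisIndex A M) := Fintype.ofFinite _
  let eflat : M ≃ₗ[A] (M →ₗ[A] A) := LinearEquiv.ofBijective D.e D.perfect
  have heflat : ∀ s t, eflat s t = D.e s t := fun _ _ => rfl
  -- `ϖ` kills `T̄`
  have hϖmax : ϖ ∈ IsLocalRing.maximalIdeal A := by
    apply hann
    rw [← pow_succ, Nat.sub_add_cancel he, hnil]
  have hϖbar : ∀ t : M, ϖ • πbar t = 0 := fun t => by
    rw [← map_smul, ← LinearMap.mem_ker, hq.ker_eq]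
    exact Submodule.smul_mem_smul hϖmax Submodule.mem_top
  refine ⟨{ e := ebar
            symm := ?_
            perfect := ⟨?_, ?_⟩
            equivariant := ?_
            twistOne := D.twistOne
            twistOne_apply := D.twistOne_apply }, hebar, rfl⟩
  · -- symmetric
    intro x y
    obtain ⟨s, rfl⟩ := hq.surjective x
    obtain ⟨t, rfl⟩ := hq.surjective y
    rw [hebar, hebar, D.symm]
  · -- injective
    intro x x' hxx'
    rw [← sub_eq_zero]
    obtain ⟨s, hs⟩ := hq.surjective (x - x')
    rw [← hs]
    have hzero : ∀ t, ϖ ^ (e - 1) * D.e s t = 0 := fun t => by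
      rw [← hebar, hs, map_sub, LinearMap.sub_apply, hxx', sub_self]
    have hsm : s ∈ (IsLocalRing.maximalIdeal A) • (⊤ : Submodule A M) := by
      have hrepr : s = ∑ i, (eflat s) (b i) • eflat.symm (b.coord i) := by
        apply eflat.injective
        rw [map_sum]
        simp_rw [map_smul, LinearEquiv.apply_symm_apply]
        exact (Module.Basis.sum_dual_apply_smul_coord b (eflat s)).symm
      rw [hrepr]
      refine Submodule.sum_mem _ fun i _ => Submodule.smul_mem_smul ?_ Submodule.mem_top
      rw [heflat]
      exact hann _ (hzero (b i))
    rw [← LinearMap.mem_ker, hq.ker_eq]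
    exact hsm
  · -- surjective
    intro G
    have hGsoc : ∀ t : M, ∃ c : A, G (πbar t) = ϖ ^ (e - 1) * c := fun t => by
      apply hsoc
      rw [← smul_eq_mul, ← map_smul, hϖbar, map_zero]
    choose c hc using hGsoc
    let g : M →ₗ[A] A := ∑ i, c (b i) • b.coord i
    refine ⟨πbar (eflat.symm g), LinearMap.ext fun y => ?_⟩
    obtain ⟨t, rfl⟩ := hq.surjective y
    rw [hebar, ← heflat, LinearEquiv.apply_symm_apply]
    conv_rhs => rw [← b.sum_repr t]
    rw [map_sum, map_sum]
    change ϖ ^ (e - 1) * (∑ i, c (b i) • b.coord i) t = _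
    rw [LinearMap.sum_apply, Finset.mul_sum]
    refine Finset.sum_congr rfl fun i _ => ?_
    rw [LinearMap.smul_apply, Module.Basis.coord_apply, smul_eq_mul, map_smul, map_smul, smul_eq_mul,
      hc (b i)]
    ring
  · -- equivariant
    intro g x y
    obtain ⟨s, rfl⟩ := hq.surjective x
    obtain ⟨t, rfl⟩ := hq.surjective y
    rw [← hq.equivariant, ← hq.equivariant]
    rw [hebar, hebar, D.equivariant, mul_left_comm]

/-! ## §2 H.5(c): `ē(θ x, θ y) = −ē(x, y)` -/

/-- **H.5(c) for the residual datum**: if `(s^τ, t^τ) ≡ −(s, t) (mod 𝔪)` (Howard's H.5(c), the tree's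
`H5c D πbar A'`), then any pairing `ē` with `ē(π̄ s, π̄ t) = ϖ^{e−1} e(s, t)` and `ϖ^{e−1}𝔪 = 0`
satisfies `ē(θ x, θ y) = −ē(x, y)` — `τ` acts on `(R/𝔪)(1)` by `χ(τ) = −1`.
[cite: Howard2004HeegnerKolyvagin, §1.3 H.5(c) (arXiv p. 7 L98 – p. 8 L1)] -/
theorem residual_e_theta_theta [IsLocalRing A] (D : DualityDatum p cd ρ A) {πbar : M →ₗ[A] Nbar}
    (hsurj : Function.Surjective πbar) (A' : ResidualTau (R := A) cd ρbar) (h5c : H5c D πbar A')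
    (ϖ : A) (e : ℕ) (hkill : ∀ a ∈ IsLocalRing.maximalIdeal A, ϖ ^ (e - 1) * a = 0)
    (Dbar : DualityDatum p cd ρbar A)
    (hDbar : ∀ s t : M, Dbar.e (πbar s) (πbar t) = ϖ ^ (e - 1) * D.e s t) (x y : Nbar) :
    Dbar.e (A'.θ x) (A'.θ y) = -Dbar.e x y := by
  obtain ⟨s, rfl⟩ := hsurj x
  obtain ⟨t, rfl⟩ := hsurj y
  obtain ⟨s', hs'⟩ := hsurj (A'.θ (πbar s))
  obtain ⟨t', ht'⟩ := hsurj (A'.θ (πbar t))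
  rw [← hs', ← ht', hDbar, hDbar]
  have h := h5c s t s' t' hs' ht'
  rw [← map_neg, Ideal.Quotient.eq] at h
  have h0 := hkill _ h
  rw [mul_sub, sub_eq_zero, mul_neg] at h0
  exact h0

end DualityDatum

/-! ## §3 On a `DVRSetting`: the residual duality datum at every level -/

namespace DVRSetting

variable {R : Type} [CommRing R] [IsDomain R] [IsDiscreteValuationRing R] [Algebra ℤ_[p] R]
  {N : ℕ → Type} [∀ k, AddCommGroup (N k)] [∀ k, TopologicalSpace (N k)]
  [∀ k, DiscreteTopology (N k)] [∀ k, Module R (N k)]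
  {Rk : ℕ → Type} [∀ k, CommRing (Rk k)] [∀ k, IsLocalRing (Rk k)] [∀ k, TopologicalSpace (Rk k)]
  [∀ k, DiscreteTopology (Rk k)] [∀ k, Algebra ℤ_[p] (Rk k)] [∀ k, Algebra R (Rk k)]
  [∀ k, Module (Rk k) (N k)] [∀ k, IsScalarTower R (Rk k) (N k)]
  [∀ k, Module (Rk k) Nbar]
  {Nq : ℕ → Finset (HeightOneSpectrum (𝓞 K)) → Type} [∀ k n, AddCommGroup (Nq k n)]
  [∀ k n, TopologicalSpace (Nq k n)] [∀ k n, DiscreteTopology (Nq k n)]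
  [∀ k n, Module (Rk k) (Nq k n)] [∀ k n, Module R (Nq k n)]
  [∀ k n, IsScalarTower R (Rk k) (Nq k n)]

/-- `1 ≤ e_k` (the exponents start at `e_0 ≥ 1` and increase). [cite: Howard2004HeegnerKolyvagin, §1.6 (arXiv p. 11 L33–34: «`T^{(k)} = T/𝔪^k T`»)] -/
theorem one_le_e (S : DVRSetting p K R N Rk Nbar Nq) (hy : S.SatisfiesH) (k : ℕ) : 1 ≤ S.e k :=
  le_trans (Nat.one_le_of_lt hy.e_zero) (hy.e_strictMono.monotone (Nat.zero_le k))

/-- `π^{e_k} = 0` in `R_k`. [cite: Howard2004HeegnerKolyvagin, §1.6 (arXiv p. 11 L33–34)] -/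
theorem algebraMap_pi_pow_e (S : DVRSetting p K R N Rk Nbar Nq) (hy : S.SatisfiesH) (k : ℕ) :
    algebraMap R (Rk k) S.π ^ S.e k = 0 := by
  rw [← map_pow, ← RingHom.mem_ker, hy.ker_algebraMap]
  exact Ideal.pow_mem_pow (S.π_mem_maximalIdeal hy) _

/-- `𝔪_{R_k} ⊆ π R_k`. [cite: Howard2004HeegnerKolyvagin, §1.6 (arXiv p. 11 L13–14: «`R` a discrete valuation ring with uniformizing parameter `π`»)] -/
theorem exists_eq_algebraMap_pi_mul (S : DVRSetting p K R N Rk Nbar Nq) (hy : S.SatisfiesH) (k : ℕ)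
    (a : Rk k) (ha : a ∈ IsLocalRing.maximalIdeal (Rk k)) : ∃ a', a = algebraMap R (Rk k) S.π * a' := by
  obtain ⟨r, rfl⟩ := hy.algebraMap_surjective k a
  have hr : ¬ IsUnit r := fun hr => (IsLocalRing.mem_maximalIdeal _).1 ha (hr.map _)
  obtain ⟨r', rfl⟩ : S.π ∣ r :=
    Ideal.mem_span_singleton.1 (hy.unif ▸ (IsLocalRing.mem_maximalIdeal r).2 hr)
  exact ⟨algebraMap R (Rk k) r', by rw [map_mul]⟩

/-- Socle: `π a = 0 ⇒ a ∈ π^{e_k - 1} R_k`. [cite: Howard2004HeegnerKolyvagin, §1.6 (arXiv p. 11 L33–34)] -/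
theorem exists_eq_pow_mul_of_pi_mul_eq_zero (S : DVRSetting p K R N Rk Nbar Nq) (hy : S.SatisfiesH)
    (k : ℕ) (a : Rk k) (ha : algebraMap R (Rk k) S.π * a = 0) :
    ∃ a', a = algebraMap R (Rk k) S.π ^ (S.e k - 1) * a' :=
  LevelRaising.exists_eq_pow_mul_of_pow_mul_eq_zero S.π (S.π_ne_zero hy) (S.e k)
    (hy.algebraMap_surjective k) (S.ker_algebraMap_le hy k) (S.one_le_e hy k) a (by rwa [pow_one])

/-- `ann(π^{e_k − 1}) ⊆ 𝔪_{R_k}`. [cite: Howard2004HeegnerKolyvagin, §1.6 (arXiv p. 11 L33–34)] -/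
theorem mem_maximalIdeal_of_pow_mul_eq_zero (S : DVRSetting p K R N Rk Nbar Nq) (hy : S.SatisfiesH)
    (k : ℕ) (a : Rk k) (ha : algebraMap R (Rk k) S.π ^ (S.e k - 1) * a = 0) :
    a ∈ IsLocalRing.maximalIdeal (Rk k) := by
  rw [IsLocalRing.mem_maximalIdeal, mem_nonunits_iff]
  intro hu
  -- then `π^{e_k - 1} = 0` in `R_k`, i.e. `π^{e_k} ∣ π^{e_k - 1}` in the domain `R`
  have h0 : algebraMap R (Rk k) (S.π ^ (S.e k - 1)) = 0 := by
    have := congrArg (· * hu.unit⁻¹.val) ha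
    simpa [mul_assoc] using this
  have hmem : S.π ^ (S.e k - 1) ∈ Ideal.span {S.π ^ S.e k} :=
    S.ker_algebraMap_le hy k ((RingHom.mem_ker).2 h0)
  obtain ⟨c, hc⟩ := Ideal.mem_span_singleton.1 hmem
  have hπu : IsUnit S.π := by
    refine isUnit_iff_exists_inv.mpr ⟨c, ?_⟩
    have h1 : S.π ^ (S.e k - 1) * 1 = S.π ^ (S.e k - 1) * (S.π * c) := by
      rw [mul_one, ← mul_assoc, ← pow_succ, Nat.sub_add_cancel (S.one_le_e hy k)]
      exact hc
    exact (mul_left_cancel₀ (pow_ne_zero _ (S.π_ne_zero hy)) h1).symm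
  exact (IsLocalRing.mem_maximalIdeal _).1 (S.π_mem_maximalIdeal hy) hπu

/-- **The residual duality datum on a `DVRSetting`** (H.4 + H.5(c) on `T̄`): at every level `k` there is
`D̄ : DualityDatum p cd ρbar R_k` with `D̄.e (π̄ s) (π̄ t) = π^{e_k−1} · e_k(s, t)` (Howard's residual
pairing `T̄ × T̄ → (R/𝔪)(1)`, `R/𝔪 ≅ π^{e_k−1}R_k`), the same twist `R(1)`, and
`D̄.e (θ x) (θ y) = −D̄.e x y` (H.5(c)). With it the duality theorems of the tree stated for a general
`DualityDatum` (e.g. `RelaxedSelmerIsotropyProofs`) apply to `T̄`.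
[cite: Howard2004HeegnerKolyvagin, §1.3 H.4 and H.5(c) (arXiv p. 7 L69–80; p. 7 L98 – p. 8 L1)] -/
theorem exists_residualDualityDatum (S : DVRSetting p K R N Rk Nbar Nq) (hy : S.SatisfiesH) (k : ℕ) :
    ∃ Dbar : DualityDatum p S.cd S.ρbar (Rk k),
      (∀ s t : N k, Dbar.e (S.πbar k s) (S.πbar k t) =
        algebraMap R (Rk k) S.π ^ (S.e k - 1) * (S.D k).e s t) ∧
      Dbar.twistOne = (S.D k).twistOne ∧
      ∀ x y : Nbar, Dbar.e ((S.A k).θ x) ((S.A k).θ y) = -Dbar.e x y := by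
  haveI : Module.Free (Rk k) (N k) := (hy.h0 k).1
  haveI : Module.Finite (Rk k) (N k) := Module.finite_of_finrank_eq_succ (hy.h0 k).2
  obtain ⟨Dbar, hD, htw⟩ := (S.D k).exists_residual (hy.h1 k).1 (algebraMap R (Rk k) S.π) (S.e k)
    (S.one_le_e hy k) (S.exists_eq_algebraMap_pi_mul hy k) (S.algebraMap_pi_pow_e hy k)
    (S.exists_eq_pow_mul_of_pi_mul_eq_zero hy k) (S.mem_maximalIdeal_of_pow_mul_eq_zero hy k)
  refine ⟨Dbar, hD, htw, fun x y => ?_⟩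
  refine (S.D k).residual_e_theta_theta (hy.h1 k).1.surjective (S.A k) (hy.h5c k) _ (S.e k)
    (fun a ha => ?_) Dbar hD x y
  obtain ⟨a', rfl⟩ := S.exists_eq_algebraMap_pi_mul hy k a ha
  rw [← mul_assoc, ← pow_succ, Nat.sub_add_cancel (S.one_le_e hy k), S.algebraMap_pi_pow_e hy k,
    zero_mul]

end DVRSetting

end Literature.NumberTheory.GaloisCohomology.Howard2004
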